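import Literature.Barriers.CriticalPhenomena.PlaquetteWalkHoleRootFarCellLaw
import Literature.Barriers.CriticalPhenomena.PlaquetteWalkMirrorDuality
import HarnessLib

/-!
# Barrier catalogue (SAWScalingLimit): the far-cell law of a hole root in ALL FOUR ORIENTATIONS, and the lane's (R-9′)
MIRROR ZEROS as theorems

Composition of `PlaquetteWalkHoleRootFarCellLaw` (b-step0: for a hole root in the `W`-normalisation — root on the `W`
side of the root plaquette `w`, hole `(w.1 − 1, w.2)`, far cell `farW w = (w.1 − 2, w.2)` — the Yang–Baxter vertex
functional of the printed weights at the far cell is `i·v(θ)·(M_N − M_S)`, in particular PURELY IMAGINARY, for every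
`θ ∈ [π/3, 2π/3]`, unconditionally) with `PlaquetteWalkMirrorDuality` (this seat: the dihedral covariance of the vertex
functional — row mirror `VF_θ(ρ·) = conj VF_{π−θ}(·)`, column mirror `VF_θ(ρ'·) = −conj VF_{π−θ}(·)`, diagonal
`VF_θ(τ·) = r(θ)·conj VF_θ(·)`; reality at `θ = π/2` on the axis of a row-symmetric list, pure imaginarity on the axis of
a column-symmetric list).

* §A ★★ the far-cell half law in the three other orientations, by transport: `E`-rooted (hole EAST of the root
  plaquette, far cell `(w.1 + 2, w.2)`): `Re VF_θ = 0` (`vertexFunctional_printed_farCellE_re_eq_zero`); `S`-rooted (hole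
  BELOW, far cell `(w.1, w.2 − 2)`) and `N`-rooted (hole ABOVE, far cell `(w.1, w.2 + 2)`): `VF_θ ∈ i·r(θ)·ℝ`, written
  `Re (conj r(θ) · VF_θ) = 0` (`…farCellS…`, `…farCellN…`) — the venture lane's observed far-cell lines `i·c_σ·ℝ`,
  `c_σ ∈ {±1, ±r}` (HOME finding «hole-neighbour directions» (H1), ADDENDUM 7), now theorems in every orientation.
* §B ★★★ THE (R-9′) MIRROR ZEROS: on a face list symmetric in the row of a horizontally rooted hole (`W`- or `E`-rooted,
  hole and root plaquette on the axis row) the far cell carries NO defect at `θ = π/2`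
  (`vertexFunctional_printed_farCellW_pi_div_two_eq_zero_of_mirror`, `…farCellE…`); on a face list symmetric in the
  column of a vertically rooted hole (`S`- or `N`-rooted) likewise (`…farCellS…`, `…farCellN…`: there `i·r(π/2)·ℝ = ℝ` meets
  `iℝ`). This is the lane's law (R-9′) (BENCH row 179; findings «(R-9) thin box», «hole-neighbour directions»,
  «two-door-cut» exceptions at `π/2`) as a theorem, including WHY `π/2` only and WHY the far cell.
* §C consequences: equal route masses `M_N(π/2) = M_S(π/2)` for a row-symmetric `W`-rooted hole
  (`routeMass_N_eq_S_of_mirror`); the far-cell defect is ODD about `π/2`: `VF_θ = −VF_{π−θ}`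
  (`vertexFunctional_printed_farCellW_eq_neg_pi_sub_of_mirror`).
* §D instances by `decide`d symmetry: the `5 × 5` box minus its centre from all four sides of the hole; the BENCH
  domain `7 × 5 ∖ (2,2)` from both horizontal sides; the `3 × 3` ring from the `N` side of its hole (the catalogue's
  `PlaquetteWalkHoleRootFarCell` vacuous zero, here a mirror zero as well).

References: A. Glazman, I. Manolescu, arXiv:1708.00395v3, Lemma 2.1 eq. (2.2) (CR), §1 eq. (1) and the remark after
it (θ ↔ π − θ) [GlazmanManolescu2019]; A. Glazman, Electron. Commun. Probab. 20 (2015) no. 86, Lemma 3.1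
[Glazman2015WeightedSAW]; H. Duminil-Copin, S. Smirnov, Ann. of Math. 175 (2012), Lemma 1 [DuminilCopinSmirnov2012].
Status: lane theorems (corollaries of the two parents; everything proved). Written for the venture lane «pcv-sawmu»
(Tier B SEARCH 1, b-engine-1 gen 17; the far-cell law is b-step0 gen 17's).
-/

noncomputable section

namespace Literature.Barriers.CriticalPhenomena.PlaquetteWalk

open Literature.Probability.RandomPlanarGeometry.SAW.YangBaxter
open Literature.Probability.RandomPlanarGeometry.SAW.YangBaxter.MidEdge
open Real Complex

/-! ## Plumbing: reflecting twice -/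

/-- Reflecting a face list twice in the same column axis gives it back. [cite: GlazmanManolescu2019, §1 (the lattice of rhombi and its mid-edges)] -/
theorem map_mirrorColFace_map_mirrorColFace (c : ℤ) (Dl : List Face) :
    (Dl.map (mirrorColFace c)).map (mirrorColFace c) = Dl := by
  rw [List.map_map]
  have : mirrorColFace c ∘ mirrorColFace c = id := funext (mirrorColFace_mirrorColFace c)
  rw [this, List.map_id]

/-- Reflecting a face list twice in the same row axis gives it back. [cite: GlazmanManolescu2019, §1 (the lattice of rhombi and its mid-edges)] -/
theorem map_mirrorRowFace_map_mirrorRowFace (c : ℤ) (Dl : List Face) :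
    (Dl.map (mirrorRowFace c)).map (mirrorRowFace c) = Dl := by
  rw [List.map_map]
  have : mirrorRowFace c ∘ mirrorRowFace c = id := funext (mirrorRowFace_mirrorRowFace c)
  rw [this, List.map_id]

/-- Reflecting a face list twice in the diagonal gives it back. [cite: GlazmanManolescu2019, §1 (the lattice of rhombi and its mid-edges)] -/
theorem map_mirrorDiagFace_map_mirrorDiagFace (Dl : List Face) :
    (Dl.map mirrorDiagFace).map mirrorDiagFace = Dl := by
  rw [List.map_map]
  have : mirrorDiagFace ∘ mirrorDiagFace = id := funext mirrorDiagFace_mirrorDiagFace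
  rw [this, List.map_id]

/-- Membership in a reflected list (column). [cite: GlazmanManolescu2019, §2.1 (finite domains of faces)] -/
theorem mem_map_mirrorColFace_iff (c : ℤ) (Dl : List Face) (f : Face) :
    mirrorColFace c f ∈ Dl.map (mirrorColFace c) ↔ f ∈ Dl := by
  rw [List.mem_map]
  constructor
  · rintro ⟨g, hg, e⟩; rwa [← mirrorColFace_injective c e]
  · intro h; exact ⟨f, h, rfl⟩

/-- Membership in a reflected list (diagonal). [cite: GlazmanManolescu2019, §2.1 (finite domains of faces)] -/
theorem mem_map_mirrorDiagFace_iff (Dl : List Face) (f : Face) :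
    mirrorDiagFace f ∈ Dl.map mirrorDiagFace ↔ f ∈ Dl := by
  rw [List.mem_map]
  constructor
  · rintro ⟨g, hg, e⟩; rwa [← mirrorDiagFace_injective e]
  · intro h; exact ⟨f, h, rfl⟩

/-! ## §A. The far-cell half law in the other three orientations -/

/-- ★★ **THE FAR-CELL LAW, every orientation, as a transport identity — `E`-rooted holes.** For the root on the `E` side of
the root plaquette `w` (hole `(w.1 + 1, w.2)`, far cell `(w.1 + 2, w.2)`), the vertex functional at the far cell at angle
`θ` is `−conj` of the `W`-rooted far-cell functional of the column-reflected list at angle `π − θ`.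
[cite: GlazmanManolescu2019, Lemma 2.1, eq. (2.2) (CR)] [cite: GlazmanManolescu2019, §1, remark after eq. (1) (θ ↔ π − θ)] -/
theorem vertexFunctional_printed_farCellE_eq_neg_conj (θ : ℝ) (Dl : List Face) (w : Face) :
    vertexFunctional (printedWeights θ) tFiveEighths (ybCoeff θ) Dl (w.side .E) (w.1 + 2, w.2) =
      -(starRingEnd ℂ) (vertexFunctional (printedWeights (π - θ)) tFiveEighths (ybCoeff (π - θ))
        (Dl.map (mirrorColFace 0)) ((mirrorColFace 0 w).side .W) (farW (mirrorColFace 0 w))) := by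
  have h := vertexFunctional_printed_map_mirrorCol_duality θ 0 (Dl.map (mirrorColFace 0)) (mirrorCol 0 (w.side .E))
    (mirrorColFace 0 (w.1 + 2, w.2))
  rw [map_mirrorColFace_map_mirrorColFace, mirrorCol_mirrorCol, mirrorColFace_mirrorColFace] at h
  rw [h, mirrorCol_side]
  obtain ⟨k, j⟩ := w
  simp only [mirrorColSide, mirrorColFace, farW]
  congr 4; ring

/-- ★★ **Far-cell half law, `E`-rooted holes**: `Re VF_D(w.side E, (w.1 + 2, w.2)) = 0` for every `θ ∈ [π/3, 2π/3]`,
every finite face list with the hole `(w.1 + 1, w.2) ∉ Dl` and the far cell `(w.1 + 2, w.2) ∈ Dl`.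
[cite: GlazmanManolescu2019, Lemma 2.1, eq. (2.2) (CR)] [cite: Glazman2015WeightedSAW, Lemma 3.1 (proof, pp. 6–7)] -/
theorem vertexFunctional_printed_farCellE_re_eq_zero {θ : ℝ} (hθ : θ ∈ Set.Icc (π / 3) (2 * π / 3))
    (Dl : List Face) (w : Face) (hf : (w.1 + 2, w.2) ∈ Dl) (hh : (w.1 + 1, w.2) ∉ dom Dl) :
    (vertexFunctional (printedWeights θ) tFiveEighths (ybCoeff θ) Dl (w.side .E) (w.1 + 2, w.2)).re = 0 := by
  have hθ' : π - θ ∈ Set.Icc (π / 3) (2 * π / 3) := ⟨by linarith [hθ.2], by linarith [hθ.1]⟩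
  have hf' : farW (mirrorColFace 0 w) ∈ Dl.map (mirrorColFace 0) := by
    have e : farW (mirrorColFace 0 w) = mirrorColFace 0 (w.1 + 2, w.2) := by
      obtain ⟨k, j⟩ := w; simp only [farW, mirrorColFace]; congr 1; ring
    rw [e, mem_map_mirrorColFace_iff]; exact hf
  have hh' : holeFaceW (mirrorColFace 0 w) ∉ dom (Dl.map (mirrorColFace 0)) := by
    have e : holeFaceW (mirrorColFace 0 w) = mirrorColFace 0 (w.1 + 1, w.2) := by
      obtain ⟨k, j⟩ := w; simp only [holeFaceW, mirrorColFace]; congr 1; ring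
    rw [e]
    intro hm
    exact hh ((mem_map_mirrorColFace_iff 0 Dl _).1 hm)
  have key := vertexFunctional_printed_farCellW_re_eq_zero hθ' (Dl.map (mirrorColFace 0)) (mirrorColFace 0 w) hf' hh'
  rw [vertexFunctional_printed_farCellE_eq_neg_conj, Complex.neg_re, Complex.conj_re, key, neg_zero]

/-- ★★ **Transport identity — `S`-rooted holes** (root on the `S` side of the root plaquette `w`, hole `(w.1, w.2 − 1)`
BELOW it, far cell `(w.1, w.2 − 2)`): the far-cell functional is `r(θ) · conj` of the `W`-rooted far-cell functional of
the DIAGONALLY reflected list at the same angle. [cite: GlazmanManolescu2019, Lemma 2.1, eq. (2.2) (CR)] -/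
theorem vertexFunctional_printed_farCellS_eq_ybRatio_mul_conj (θ : ℝ) (Dl : List Face) (w : Face) :
    vertexFunctional (printedWeights θ) tFiveEighths (ybCoeff θ) Dl (w.side .S) (w.1, w.2 - 2) =
      ybRatio θ * (starRingEnd ℂ) (vertexFunctional (printedWeights θ) tFiveEighths (ybCoeff θ)
        (Dl.map mirrorDiagFace) ((mirrorDiagFace w).side .W) (farW (mirrorDiagFace w))) := by
  have h := vertexFunctional_printed_map_mirrorDiag θ (Dl.map mirrorDiagFace) (mirrorDiag (w.side .S))
    (mirrorDiagFace (w.1, w.2 - 2))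
  rw [map_mirrorDiagFace_map_mirrorDiagFace, mirrorDiag_mirrorDiag, mirrorDiagFace_mirrorDiagFace] at h
  rw [h, mirrorDiag_side]
  obtain ⟨k, j⟩ := w
  simp only [mirrorDiagSide, mirrorDiagFace, farW]

/-- ★★ **Far-cell law, `S`-rooted holes**: the functional lies on the line `i·r(θ)·ℝ`: `Re (conj r(θ) · VF) = 0`, for
every `θ ∈ [π/3, 2π/3]` (hole `(w.1, w.2 − 1) ∉ Dl`, far cell `(w.1, w.2 − 2) ∈ Dl`). (The venture lane's observed
direction `arg(i·r)` for vertically rooted holes.) [cite: GlazmanManolescu2019, Lemma 2.1, eq. (2.2) (CR)] [cite: Glazman2015WeightedSAW, Lemma 3.1 (proof, pp. 6–7)] -/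
theorem vertexFunctional_printed_farCellS_re_eq_zero {θ : ℝ} (hθ : θ ∈ Set.Icc (π / 3) (2 * π / 3))
    (Dl : List Face) (w : Face) (hf : (w.1, w.2 - 2) ∈ Dl) (hh : (w.1, w.2 - 1) ∉ dom Dl) :
    ((starRingEnd ℂ) (ybRatio θ) *
      vertexFunctional (printedWeights θ) tFiveEighths (ybCoeff θ) Dl (w.side .S) (w.1, w.2 - 2)).re = 0 := by
  have hf' : farW (mirrorDiagFace w) ∈ Dl.map mirrorDiagFace := by
    have e : farW (mirrorDiagFace w) = mirrorDiagFace (w.1, w.2 - 2) := by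
      obtain ⟨k, j⟩ := w; simp only [farW, mirrorDiagFace]
    rw [e, mem_map_mirrorDiagFace_iff]; exact hf
  have hh' : holeFaceW (mirrorDiagFace w) ∉ dom (Dl.map mirrorDiagFace) := by
    have e : holeFaceW (mirrorDiagFace w) = mirrorDiagFace (w.1, w.2 - 1) := by
      obtain ⟨k, j⟩ := w; simp only [holeFaceW, mirrorDiagFace]
    rw [e]
    intro hm
    exact hh ((mem_map_mirrorDiagFace_iff Dl _).1 hm)
  have key := vertexFunctional_printed_farCellW_re_eq_zero hθ (Dl.map mirrorDiagFace) (mirrorDiagFace w) hf' hh'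
  have hr := conj_ybRatio_mul_ybRatio θ
  rw [vertexFunctional_printed_farCellS_eq_ybRatio_mul_conj, ← mul_assoc, hr, one_mul, Complex.conj_re, key]

/-- ★★ **Transport identity — `N`-rooted holes** (root on the `N` side of `w`, hole `(w.1, w.2 + 1)` ABOVE it, far cell
`(w.1, w.2 + 2)`): `r(θ) · conj` of the `E`-rooted far-cell functional of the diagonally reflected list.
[cite: GlazmanManolescu2019, Lemma 2.1, eq. (2.2) (CR)] -/
theorem vertexFunctional_printed_farCellN_eq_ybRatio_mul_conj (θ : ℝ) (Dl : List Face) (w : Face) :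
    vertexFunctional (printedWeights θ) tFiveEighths (ybCoeff θ) Dl (w.side .N) (w.1, w.2 + 2) =
      ybRatio θ * (starRingEnd ℂ) (vertexFunctional (printedWeights θ) tFiveEighths (ybCoeff θ)
        (Dl.map mirrorDiagFace) ((mirrorDiagFace w).side .E) ((mirrorDiagFace w).1 + 2, (mirrorDiagFace w).2)) := by
  have h := vertexFunctional_printed_map_mirrorDiag θ (Dl.map mirrorDiagFace) (mirrorDiag (w.side .N))
    (mirrorDiagFace (w.1, w.2 + 2))
  rw [map_mirrorDiagFace_map_mirrorDiagFace, mirrorDiag_mirrorDiag, mirrorDiagFace_mirrorDiagFace] at h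
  rw [h, mirrorDiag_side]
  obtain ⟨k, j⟩ := w
  simp only [mirrorDiagSide, mirrorDiagFace]

/-- ★★ **Far-cell law, `N`-rooted holes**: `Re (conj r(θ) · VF) = 0` for every `θ ∈ [π/3, 2π/3]` (hole `(w.1, w.2 + 1) ∉ Dl`,
far cell `(w.1, w.2 + 2) ∈ Dl`). [cite: GlazmanManolescu2019, Lemma 2.1, eq. (2.2) (CR)] [cite: Glazman2015WeightedSAW, Lemma 3.1 (proof, pp. 6–7)] -/
theorem vertexFunctional_printed_farCellN_re_eq_zero {θ : ℝ} (hθ : θ ∈ Set.Icc (π / 3) (2 * π / 3))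
    (Dl : List Face) (w : Face) (hf : (w.1, w.2 + 2) ∈ Dl) (hh : (w.1, w.2 + 1) ∉ dom Dl) :
    ((starRingEnd ℂ) (ybRatio θ) *
      vertexFunctional (printedWeights θ) tFiveEighths (ybCoeff θ) Dl (w.side .N) (w.1, w.2 + 2)).re = 0 := by
  have hf' : ((mirrorDiagFace w).1 + 2, (mirrorDiagFace w).2) ∈ Dl.map mirrorDiagFace := by
    have e : ((mirrorDiagFace w).1 + 2, (mirrorDiagFace w).2) = mirrorDiagFace (w.1, w.2 + 2) := by
      obtain ⟨k, j⟩ := w; simp only [mirrorDiagFace]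
    rw [e, mem_map_mirrorDiagFace_iff]; exact hf
  have hh' : ((mirrorDiagFace w).1 + 1, (mirrorDiagFace w).2) ∉ dom (Dl.map mirrorDiagFace) := by
    have e : ((mirrorDiagFace w).1 + 1, (mirrorDiagFace w).2) = mirrorDiagFace (w.1, w.2 + 1) := by
      obtain ⟨k, j⟩ := w; simp only [mirrorDiagFace]
    rw [e]
    intro hm
    exact hh ((mem_map_mirrorDiagFace_iff Dl _).1 hm)
  have key := vertexFunctional_printed_farCellE_re_eq_zero hθ (Dl.map mirrorDiagFace) (mirrorDiagFace w) hf' hh'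
  have hr := conj_ybRatio_mul_ybRatio θ
  rw [vertexFunctional_printed_farCellN_eq_ybRatio_mul_conj, ← mul_assoc, hr, one_mul, Complex.conj_re, key]

/-! ## §B. The (R-9′) mirror zeros at `θ = π/2` -/

/-- `π/2` lies in the printed range. [cite: GlazmanManolescu2019, §1 (θ ∈ [π/3, 2π/3])] -/
theorem pi_div_two_mem_printedRange : (π / 2 : ℝ) ∈ Set.Icc (π / 3) (2 * π / 3) :=
  ⟨by linarith [Real.pi_pos], by linarith [Real.pi_pos]⟩

/-- ★★★ **(R-9′) MIRROR ZERO, `W`-rooted**: on a face list symmetric in the axis of row `c`, for a root plaquette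
`(k, c)` on the axis whose `W` neighbour (the hole) is missing and whose second `W` neighbour (the far cell) is present,
the Yang–Baxter vertex functional of the printed weights AT `θ = π/2` VANISHES at the far cell: its real part vanishes by
the far-cell law, its imaginary part by mirror reality. [cite: GlazmanManolescu2019, Lemma 2.1, eq. (2.2) (CR)]
[cite: GlazmanManolescu2019, §1, remark after eq. (1) (θ ↔ π − θ)] [cite: DuminilCopinSmirnov2012, Lemma 1 (shape of the relation)] -/
theorem vertexFunctional_printed_farCellW_pi_div_two_eq_zero_of_mirror (c : ℤ) {Dl : List Face}
    (hsym : ∀ f ∈ Dl, mirrorRowFace c f ∈ Dl) (k : ℤ) (hf : farW (k, c) ∈ Dl) (hh : holeFaceW (k, c) ∉ dom Dl) :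
    vertexFunctional (printedWeights (π / 2)) tFiveEighths (ybCoeff (π / 2)) Dl (Face.side (k, c) .W) (farW (k, c)) = 0 := by
  refine Complex.ext ?_ ?_
  · rw [Complex.zero_re]
    exact vertexFunctional_printed_farCellW_re_eq_zero pi_div_two_mem_printedRange Dl (k, c) hf hh
  · rw [Complex.zero_im]
    exact vertexFunctional_printed_pi_div_two_im_eq_zero_of_mirror c hsym k (k - 2)

/-- ★★★ **(R-9′) MIRROR ZERO, `E`-rooted** (hole `(k + 1, c)`, far cell `(k + 2, c)`).
[cite: GlazmanManolescu2019, Lemma 2.1, eq. (2.2) (CR)] [cite: GlazmanManolescu2019, §1, remark after eq. (1) (θ ↔ π − θ)] -/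
theorem vertexFunctional_printed_farCellE_pi_div_two_eq_zero_of_mirror (c : ℤ) {Dl : List Face}
    (hsym : ∀ f ∈ Dl, mirrorRowFace c f ∈ Dl) (k : ℤ) (hf : (k + 2, c) ∈ Dl) (hh : (k + 1, c) ∉ dom Dl) :
    vertexFunctional (printedWeights (π / 2)) tFiveEighths (ybCoeff (π / 2)) Dl (Face.side (k, c) .E) (k + 2, c) = 0 := by
  refine Complex.ext ?_ ?_
  · rw [Complex.zero_re]
    exact vertexFunctional_printed_farCellE_re_eq_zero pi_div_two_mem_printedRange Dl (k, c) hf hh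
  · rw [Complex.zero_im]
    exact vertexFunctional_printed_pi_div_two_im_eq_zero_of_mirror c hsym (k + 1) (k + 2)

/-- ★★★ **(R-9′) MIRROR ZERO, `S`-rooted** (root on the `S` side of `(c, j)` = the `N` side of the hole `(c, j − 1)`;
far cell `(c, j − 2)`), on a face list symmetric in the axis of COLUMN `c`: `i·r(π/2)·ℝ = ℝ` (far-cell law) meets `iℝ`
(column reality). [cite: GlazmanManolescu2019, Lemma 2.1, eq. (2.2) (CR)] [cite: GlazmanManolescu2019, §1, remark after eq. (1) (θ ↔ π − θ)] -/
theorem vertexFunctional_printed_farCellS_pi_div_two_eq_zero_of_mirrorCol (c : ℤ) {Dl : List Face}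
    (hsym : ∀ f ∈ Dl, mirrorColFace c f ∈ Dl) (j : ℤ) (hf : (c, j - 2) ∈ Dl) (hh : (c, j - 1) ∉ dom Dl) :
    vertexFunctional (printedWeights (π / 2)) tFiveEighths (ybCoeff (π / 2)) Dl (Face.side (c, j) .S) (c, j - 2) = 0 := by
  have hre := vertexFunctional_printed_pi_div_two_re_eq_zero_of_mirrorCol c hsym j (j - 2)
  have hli := vertexFunctional_printed_farCellS_re_eq_zero pi_div_two_mem_printedRange Dl (c, j) hf hh
  rw [ybRatio_pi_div_two, Complex.conj_I] at hli
  set z := vertexFunctional (printedWeights (π / 2)) tFiveEighths (ybCoeff (π / 2)) Dl (Face.side (c, j) .S) (c, j - 2)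
  have him : z.im = 0 := by
    have : (-Complex.I * z).re = z.im := by simp [Complex.mul_re]
    rw [← this]; exact hli
  exact Complex.ext (by rw [Complex.zero_re]; exact hre) (by rw [Complex.zero_im]; exact him)

/-- ★★★ **(R-9′) MIRROR ZERO, `N`-rooted** (root on the `N` side of `(c, j)` = the `S` side of the hole `(c, j + 1)`;
far cell `(c, j + 2)`), on a face list symmetric in the axis of column `c`.
[cite: GlazmanManolescu2019, Lemma 2.1, eq. (2.2) (CR)] [cite: GlazmanManolescu2019, §1, remark after eq. (1) (θ ↔ π − θ)] -/
theorem vertexFunctional_printed_farCellN_pi_div_two_eq_zero_of_mirrorCol (c : ℤ) {Dl : List Face}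
    (hsym : ∀ f ∈ Dl, mirrorColFace c f ∈ Dl) (j : ℤ) (hf : (c, j + 2) ∈ Dl) (hh : (c, j + 1) ∉ dom Dl) :
    vertexFunctional (printedWeights (π / 2)) tFiveEighths (ybCoeff (π / 2)) Dl (Face.side (c, j) .N) (c, j + 2) = 0 := by
  have hre := vertexFunctional_printed_pi_div_two_re_eq_zero_of_mirrorCol c hsym (j + 1) (j + 2)
  have hli := vertexFunctional_printed_farCellN_re_eq_zero pi_div_two_mem_printedRange Dl (c, j) hf hh
  rw [ybRatio_pi_div_two, Complex.conj_I] at hli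
  set z := vertexFunctional (printedWeights (π / 2)) tFiveEighths (ybCoeff (π / 2)) Dl (Face.side (c, j) .N) (c, j + 2)
  have him : z.im = 0 := by
    have : (-Complex.I * z).re = z.im := by simp [Complex.mul_re]
    rw [← this]; exact hli
  exact Complex.ext (by rw [Complex.zero_re]; exact hre) (by rw [Complex.zero_im]; exact him)

/-! ## §C. Equal route masses at `π/2`; the defect is odd about `π/2` -/

/-- ★★ **Equal route masses at the self-dual angle**: for a row-symmetric `W`-rooted hole, the total wound weight of the
class-`B2a` walks at the far cell that passed OVER the hole equals that of the walks that passed UNDER it, at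
`θ = π/2`. [cite: GlazmanManolescu2019, Lemma 2.1 (statement, "in the form given in [Gl]")] [cite: Glazman2015WeightedSAW, Lemma 3.1 (proof, pp. 6–7)] -/
theorem routeMass_N_eq_S_of_mirror (c : ℤ) {Dl : List Face} (hsym : ∀ f ∈ Dl, mirrorRowFace c f ∈ Dl) (k : ℤ)
    (hf : farW (k, c) ∈ Dl) (hh : holeFaceW (k, c) ∉ dom Dl)
    (hr : RootedFace (dom Dl) (Face.side (k, c) .W) (farW (k, c))) :
    ∑ ω ∈ ΩG.setB2a (dom Dl) (Face.side (k, c) .W) (farW (k, c)), ΩG.routeMassW (π / 2) hr .N ω =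
      ∑ ω ∈ ΩG.setB2a (dom Dl) (Face.side (k, c) .W) (farW (k, c)), ΩG.routeMassW (π / 2) hr .S ω :=
  (vertexFunctional_printed_farCellW_eq_zero_iff pi_div_two_mem_printedRange Dl (k, c) hf hh hr).1
    (vertexFunctional_printed_farCellW_pi_div_two_eq_zero_of_mirror c hsym k hf hh)

/-- ★★ **The far-cell defect of a row-symmetric `W`-rooted hole is ODD about `θ = π/2`**: `VF_θ = −VF_{π−θ}` (it is
purely imaginary at both angles and `VF_θ = conj VF_{π−θ}` by mirror duality). [cite: GlazmanManolescu2019, Lemma 2.1, eq. (2.2) (CR)]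
[cite: GlazmanManolescu2019, §1, remark after eq. (1) (θ ↔ π − θ)] -/
theorem vertexFunctional_printed_farCellW_eq_neg_pi_sub_of_mirror {θ : ℝ} (hθ : θ ∈ Set.Icc (π / 3) (2 * π / 3))
    (c : ℤ) {Dl : List Face} (hsym : ∀ f ∈ Dl, mirrorRowFace c f ∈ Dl) (k : ℤ) (hf : farW (k, c) ∈ Dl)
    (hh : holeFaceW (k, c) ∉ dom Dl) :
    vertexFunctional (printedWeights θ) tFiveEighths (ybCoeff θ) Dl (Face.side (k, c) .W) (farW (k, c)) =
      -vertexFunctional (printedWeights (π - θ)) tFiveEighths (ybCoeff (π - θ)) Dl (Face.side (k, c) .W) (farW (k, c)) := by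
  have hθ' : π - θ ∈ Set.Icc (π / 3) (2 * π / 3) := ⟨by linarith [hθ.2], by linarith [hθ.1]⟩
  have hd := vertexFunctional_printed_mirror_duality θ c hsym k (k - 2)
  have hre := vertexFunctional_printed_farCellW_re_eq_zero hθ' Dl (k, c) hf hh
  -- `VF_θ = conj VF' = −VF'` since `VF'` is purely imaginary
  change vertexFunctional _ _ _ Dl (MidEdge.vert k c) (k - 2, c) = -vertexFunctional _ _ _ Dl (MidEdge.vert k c) (k - 2, c)
  change (vertexFunctional _ _ _ Dl (MidEdge.vert k c) (k - 2, c)).re = 0 at hre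
  rw [hd]
  set z := vertexFunctional (printedWeights (π - θ)) tFiveEighths (ybCoeff (π - θ)) Dl (MidEdge.vert k c) (k - 2, c)
  exact Complex.ext (by rw [Complex.conj_re, Complex.neg_re, hre, neg_zero]) (by rw [Complex.conj_im, Complex.neg_im])

/-! ## §D. Instances: the lane's mirror-symmetric holed boxes -/

/-- `sq5hole` is symmetric in the axis of its middle COLUMN as well. [cite: GlazmanManolescu2019, §2.1 (finite domains of faces; walks as sequences of mid-edges)] -/
theorem sq5hole_symmetric_col : ∀ f ∈ sq5hole, mirrorColFace 2 f ∈ sq5hole := by decide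

/-- ★★ **`sq5hole`, `W`-rooted** (root `W` side of `(3,2)`, the lane's «sq5hole W(3,2)»): the far cell `(1,2)` carries NO
defect at `θ = π/2` — the (R-9′) zero of the venture lane's first thick-box table, now a theorem.
[cite: GlazmanManolescu2019, Lemma 2.1, eq. (2.2) (CR)] -/
theorem vertexFunctional_printed_sq5hole_W_farCell_eq_zero :
    vertexFunctional (printedWeights (π / 2)) tFiveEighths (ybCoeff (π / 2)) sq5hole (Face.side (3, 2) .W) (1, 2) = 0 :=
  vertexFunctional_printed_farCellW_pi_div_two_eq_zero_of_mirror 2 sq5hole_symmetric 3 (by decide)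
    (by change ¬ (((2 : ℤ), (2 : ℤ)) ∈ sq5hole); decide)

/-- ★★ **`sq5hole`, `E`-rooted** (root `E` side of `(1,2)`): far cell `(3,2)`, zero at `π/2`. [cite: GlazmanManolescu2019, Lemma 2.1, eq. (2.2) (CR)] -/
theorem vertexFunctional_printed_sq5hole_E_farCell_eq_zero :
    vertexFunctional (printedWeights (π / 2)) tFiveEighths (ybCoeff (π / 2)) sq5hole (Face.side (1, 2) .E) (3, 2) = 0 :=
  vertexFunctional_printed_farCellE_pi_div_two_eq_zero_of_mirror 2 sq5hole_symmetric 1 (by decide)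
    (by change ¬ (((2 : ℤ), (2 : ℤ)) ∈ sq5hole); decide)

/-- ★★ **`sq5hole`, `S`-rooted** (root `S` side of `(2,3)` = `N` side of the hole): far cell `(2,1)`, zero at `π/2`.
[cite: GlazmanManolescu2019, Lemma 2.1, eq. (2.2) (CR)] -/
theorem vertexFunctional_printed_sq5hole_S_farCell_eq_zero :
    vertexFunctional (printedWeights (π / 2)) tFiveEighths (ybCoeff (π / 2)) sq5hole (Face.side (2, 3) .S) (2, 1) = 0 :=
  vertexFunctional_printed_farCellS_pi_div_two_eq_zero_of_mirrorCol 2 sq5hole_symmetric_col 3 (by decide)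
    (by change ¬ (((2 : ℤ), (2 : ℤ)) ∈ sq5hole); decide)

/-- ★★ **`sq5hole`, `N`-rooted** (root `N` side of `(2,1)` = `S` side of the hole): far cell `(2,3)`, zero at `π/2`.
[cite: GlazmanManolescu2019, Lemma 2.1, eq. (2.2) (CR)] -/
theorem vertexFunctional_printed_sq5hole_N_farCell_eq_zero :
    vertexFunctional (printedWeights (π / 2)) tFiveEighths (ybCoeff (π / 2)) sq5hole (Face.side (2, 1) .N) (2, 3) = 0 :=
  vertexFunctional_printed_farCellN_pi_div_two_eq_zero_of_mirrorCol 2 sq5hole_symmetric_col 1 (by decide)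
    (by change ¬ (((2 : ℤ), (2 : ℤ)) ∈ sq5hole); decide)

/-- ★★ **BENCH row 179's domain `7 × 5 ∖ (2,2)`, `W`-rooted** (root `W` side of `(3,2)`): far cell `(1,2)`, zero at
`π/2` — although the box is NOT left-right symmetric about its hole. [cite: GlazmanManolescu2019, Lemma 2.1, eq. (2.2) (CR)] -/
theorem vertexFunctional_printed_box75hole_W_farCell_eq_zero :
    vertexFunctional (printedWeights (π / 2)) tFiveEighths (ybCoeff (π / 2)) box75hole (Face.side (3, 2) .W) (1, 2) = 0 :=
  vertexFunctional_printed_farCellW_pi_div_two_eq_zero_of_mirror 2 box75hole_symmetric 3 (by decide)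
    (by change ¬ (((2 : ℤ), (2 : ℤ)) ∈ box75hole); decide)

/-- ★★ **`7 × 5 ∖ (2,2)`, `E`-rooted** (root `E` side of `(1,2)`): far cell `(3,2)`, zero at `π/2`.
[cite: GlazmanManolescu2019, Lemma 2.1, eq. (2.2) (CR)] -/
theorem vertexFunctional_printed_box75hole_E_farCell_eq_zero :
    vertexFunctional (printedWeights (π / 2)) tFiveEighths (ybCoeff (π / 2)) box75hole (Face.side (1, 2) .E) (3, 2) = 0 :=
  vertexFunctional_printed_farCellE_pi_div_two_eq_zero_of_mirror 2 box75hole_symmetric 1 (by decide)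
    (by change ¬ (((2 : ℤ), (2 : ℤ)) ∈ box75hole); decide)

/-- ★★ **The `3 × 3` ring from the `N` side of its hole** (root `S` side of `(1,2)` = the catalogue's `holeRoot` of
`PlaquetteWalkHoleRootFarCell`): the far cell `(1,0)` is zero at `π/2` for a second reason — a mirror zero (the
catalogue proves it zero at every `θ`, a vacuous zero of the thin ring). [cite: GlazmanManolescu2019, Lemma 2.1, eq. (2.2) (CR)] -/
theorem vertexFunctional_printed_ring8'_S_farCell_eq_zero :
    vertexFunctional (printedWeights (π / 2)) tFiveEighths (ybCoeff (π / 2)) ring8' (Face.side (1, 2) .S) (1, 0) = 0 :=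
  vertexFunctional_printed_farCellS_pi_div_two_eq_zero_of_mirrorCol 1 ring8'_symmetric 2 (by decide)
    (by change ¬ (((1 : ℤ), (1 : ℤ)) ∈ ring8'); decide)

/-- Named statement **`PlaquetteWalkHoleRootMirrorZeros`**: on every finite face list symmetric in the axis of row `c`,
for every root plaquette `(k, c)` whose `W` neighbour is missing and whose second `W` neighbour is present, the
Yang–Baxter vertex functional of the printed weights at `θ = π/2` vanishes at that far cell. [cite: GlazmanManolescu2019, Lemma 2.1, eq. (2.2) (CR)] -/
def PlaquetteWalkHoleRootMirrorZeros : Prop :=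
  ∀ (c : ℤ) (Dl : List Face), (∀ f ∈ Dl, mirrorRowFace c f ∈ Dl) → ∀ k : ℤ, farW (k, c) ∈ Dl → holeFaceW (k, c) ∉ dom Dl →
    vertexFunctional (printedWeights (π / 2)) tFiveEighths (ybCoeff (π / 2)) Dl (Face.side (k, c) .W) (farW (k, c)) = 0

/-- `PlaquetteWalkHoleRootMirrorZeros` holds. [cite: GlazmanManolescu2019, Lemma 2.1, eq. (2.2) (CR)] -/
theorem PlaquetteWalkHoleRootMirrorZeros_holds : PlaquetteWalkHoleRootMirrorZeros :=
  fun c _ hsym k hf hh => vertexFunctional_printed_farCellW_pi_div_two_eq_zero_of_mirror c hsym k hf hh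

end Literature.Barriers.CriticalPhenomena.PlaquetteWalk
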